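import Summits.Ventures.PercRepro.ExcessOneTraceSided
import Summits.Ventures.PercRepro.ExcessOneCoverLemma
import Summits.Ventures.PercRepro.ExcessOneTraceIdentity

/-!
# The residue statement (RM*): the setting and the three lemmas at the `r`-only singletons

Setting (proofs/MINE1-theoremS.md, Addenda 28, 31, 35): `F` has Marica–Schönheim excess one,
`{r} ∈ F`, `∅ ∉ F`, the trace `P = proj r F` is tight with every singleton (a simplicial
complex), the labelling is *monotone* (`F₁ = partr r F` a down-set, `F₀ = part0 r F` an up-set
of `P`), `u₀ ⊆ S' = univ ∖ {r}` is a member avoiding `r` without its `r`-partner, its complement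
`ū = ubar r u₀` inside `S'` is not `r`-lifted, every `s ∈ F₀` is *signable* (`ū ∖ s ∈ P` or
`u₀ ∖ s ∈ Y`) and some `s*` is *A-only* (`ū ∖ s* ∈ P`, `u₀ ∖ s* ∉ Y`) — the hypotheses
(H2)–(H4) of (RM*); the theorem (`MSRMStarTheorem.lean`) says that then every `r`-lifted face is
a member avoiding `r` or `∅`. Here: the structure `RMStar` and the three lemmas of Addendum 31
at the **`r`-only singletons** (`{y} ∉ F₀`, so `{y, r} ∈ F`): every `r`-only `y ∈ u₀` is a
tightening direction (`tight_proj_of_mem_u0`; at a non-tightening `y` Theorem (NT) lifts `u₀` to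
a member `u₀ ∪ R_y ∋ r`); at an `r`-only tightening `y` the tight `proj y F` is closed under
adding the class of `r` (Theorem S), so `s.erase y ∈ F₁` for every `s ∈ F₀`
(`erase_mem_partr_of_tight`); every `r`-only `z ∈ ū` is non-tightening
(`not_tight_proj_of_mem_ubar`), members containing `z` are partner members
(`mem_partr_of_mem_of_mem_ubar`), and `s ∩ R_z` is a partner member of `F` at `r` for every
`s ∈ F₀` avoiding `z` (`inter_Rstar_mem_partner_of_mem_ubar`).
-/

namespace PercRepro.MSTight

open Finset
open scoped FinsetFamily symmDiff

variable {α : Type*} [DecidableEq α] [Fintype α]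

/-- The complement of `u₀` inside `S' = univ ∖ {r}`. -/
def ubar (r : α) (u₀ : Finset α) : Finset α := Finset.univ \ insert r u₀

/-- Membership in `ubar r u₀`. -/
theorem mem_ubar {r a : α} {u₀ : Finset α} : a ∈ ubar r u₀ ↔ a ≠ r ∧ a ∉ u₀ := by
  simp only [ubar, mem_sdiff, mem_univ, mem_insert, true_and, not_or]

/-- `r ∉ ū`. -/
theorem notMem_ubar_self (r : α) (u₀ : Finset α) : r ∉ ubar r u₀ := fun h =>
  (mem_ubar.1 h).1 rfl

/-- `ū` and `u₀` are disjoint. -/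
theorem disjoint_ubar (r : α) (u₀ : Finset α) : Disjoint (ubar r u₀) u₀ := by
  rw [Finset.disjoint_left]
  intro a ha
  exact (mem_ubar.1 ha).2

/-- **The (RM*) setting** (Addendum 28, residue form): excess one, `{r} ∈ F`, `∅ ∉ F`, a tight
trace with all singletons, monotone labelling, and the near-member data (H2)–(H4) at `u₀`. -/
structure RMStar (r : α) (F : Finset (Finset α)) (u₀ : Finset α) : Prop where
  exc : (F \\ F).card = F.card + 1
  tightP : Tight (proj r F)
  singleton_mem : ({r} : Finset α) ∈ F
  empty_notMem : (∅ : Finset α) ∉ F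
  sing : ∀ a, a ≠ r → ({a} : Finset α) ∈ proj r F
  down : ∀ t ∈ partr r F, ∀ e ∈ proj r F, e ⊆ t → e ∈ partr r F
  up : ∀ s ∈ part0 r F, ∀ e ∈ proj r F, s ⊆ e → e ∈ part0 r F
  u0_mem : u₀ ∈ part0 r F
  u0_notMem : u₀ ∉ partr r F
  ubar_notMem : ubar r u₀ ∉ partr r F
  signable : ∀ s ∈ part0 r F, ubar r u₀ \ s ∈ proj r F ∨ u₀ \ s ∈ diffsY r F
  aonly : ∃ s ∈ part0 r F, ubar r u₀ \ s ∈ proj r F ∧ u₀ \ s ∉ diffsY r F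

namespace RMStar

variable {r : α} {F : Finset (Finset α)} {u₀ : Finset α}

/-- `r ∉ u₀`. -/
theorem r_notMem_u0 (h : RMStar r F u₀) : r ∉ u₀ := (mem_part0.1 h.u0_mem).2

/-- `u₀` is a member. -/
theorem u0_mem_F (h : RMStar r F u₀) : u₀ ∈ F := (mem_part0.1 h.u0_mem).1

/-- The trace is a simplicial complex. -/
theorem mem_proj_of_subset' (h : RMStar r F u₀) {e : Finset α} (he : e ∈ proj r F)
    {e' : Finset α} (he' : e' ⊆ e) : e' ∈ proj r F :=
  mem_proj_of_subset h.tightP h.singleton_mem h.sing he he'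

omit [Fintype α] in
/-- A member avoiding `r` is a face of the trace. -/
theorem mem_proj_of_mem_part0 {s : Finset α} (hs : s ∈ part0 r F) : s ∈ proj r F := by
  rw [proj_eq_union]; exact mem_union_left _ hs

omit [Fintype α] in
/-- An `r`-lifted set is a face of the trace. -/
theorem mem_proj_of_mem_partr {t : Finset α} (ht : t ∈ partr r F) : t ∈ proj r F := by
  rw [proj_eq_union]; exact mem_union_right _ ht

omit [Fintype α] in
/-- Every face of the trace is a member avoiding `r` or `r`-lifted. -/
theorem part0_or_partr {e : Finset α} (he : e ∈ proj r F) :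
    e ∈ part0 r F ∨ e ∈ partr r F := by
  rw [proj_eq_union] at he
  exact mem_union.1 he

/-- `u₀` is a face of the trace. -/
theorem u0_mem_proj (h : RMStar r F u₀) : u₀ ∈ proj r F := mem_proj_of_mem_part0 h.u0_mem

/-- `∅` is `r`-lifted (`{r} ∈ F`). -/
theorem empty_mem_partr (h : RMStar r F u₀) : (∅ : Finset α) ∈ partr r F :=
  mem_partr.2 ⟨notMem_empty r, by simpa using h.singleton_mem⟩

/-- `u₀ ≠ ∅`, since `∅` is `r`-lifted and `u₀` is not. -/
theorem u0_nonempty (h : RMStar r F u₀) : u₀.Nonempty := by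
  rw [nonempty_iff_ne_empty]
  rintro rfl
  exact h.u0_notMem h.empty_mem_partr

/-- Every type-I difference is `r`-lifted (`F₁` is a down-set). -/
theorem diffsY_subset (h : RMStar r F u₀) : diffsY r F ⊆ partr r F :=
  diffsY_subset_partr_of_downSet h.tightP h.singleton_mem h.sing h.down

/-- The differences avoiding `r` are exactly the faces of the trace. -/
theorem diffsX_eq (h : RMStar r F u₀) : diffsX r F = proj r F :=
  diffsX_eq_proj_of_singleton_mem h.tightP h.singleton_mem

/-- `|Y| = |K| + 1`: the excess-one count at a complex trace. -/
theorem card_diffsY (h : RMStar r F u₀) : (diffsY r F).card = (partner r F).card + 1 :=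
  card_diffsY_of_singleton_mem h.tightP h.singleton_mem h.exc

/-- A type-I difference is an `r`-lifted face disjoint from a member avoiding `r`, and
conversely. -/
theorem mem_diffsY_iff (h : RMStar r F u₀) {t : Finset α} :
    t ∈ diffsY r F ↔ t ∈ partr r F ∧ ∃ s ∈ part0 r F, Disjoint t s := by
  constructor
  · intro ht
    refine ⟨h.diffsY_subset ht, ?_⟩
    obtain ⟨t', _, s, hs, rfl⟩ := Finset.mem_diffs.1 ht
    exact ⟨s, hs, sdiff_disjoint⟩
  · rintro ⟨ht, s, hs, hd⟩
    exact mem_diffsY_of_disjoint ht hs hd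

/-- `u₀` is not a type-I difference. -/
theorem u0_notMem_diffsY (h : RMStar r F u₀) : u₀ ∉ diffsY r F := fun hu =>
  h.u0_notMem (h.diffsY_subset hu)

/-- `ū` is not a type-I difference. -/
theorem ubar_notMem_diffsY (h : RMStar r F u₀) : ubar r u₀ ∉ diffsY r F := fun hu =>
  h.ubar_notMem (h.diffsY_subset hu)

/-- The one-sided trace reduction applied to `W = u₀`: if every singleton of `u₀` is a member
avoiding `r`, the conclusion of (RM*) holds. -/
theorem partr_subset_of_u0_sided (h : RMStar r F u₀)
    (hW : ∀ y ∈ u₀, ({y} : Finset α) ∈ part0 r F) : partr r F ⊆ insert ∅ (part0 r F) :=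
  partr_subset_insert_empty_of_sided h.exc h.tightP h.singleton_mem h.empty_notMem h.sing h.down
    h.u0_notMem hW

/-- The one-sided trace reduction applied to `W = ū`. -/
theorem partr_subset_of_ubar_sided (h : RMStar r F u₀)
    (hW : ∀ z ∈ ubar r u₀, ({z} : Finset α) ∈ part0 r F) :
    partr r F ⊆ insert ∅ (part0 r F) :=
  partr_subset_insert_empty_of_sided h.exc h.tightP h.singleton_mem h.empty_notMem h.sing h.down
    h.ubar_notMem hW

/-! ### `r`-only singletons -/

/-- A singleton `{y}`, `y ≠ r`, that is not a member avoiding `r` is `r`-lifted. -/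
theorem singleton_mem_partr (h : RMStar r F u₀) {y : α} (hy : y ≠ r)
    (hy0 : ({y} : Finset α) ∉ part0 r F) : ({y} : Finset α) ∈ partr r F :=
  (part0_or_partr (h.sing y hy)).resolve_left hy0

omit [Fintype α] in
/-- An `r`-only singleton is not a member. -/
theorem singleton_notMem {y : α} (hy : y ≠ r)
    (hy0 : ({y} : Finset α) ∉ part0 r F) : ({y} : Finset α) ∉ F := fun hyF =>
  hy0 (mem_part0.2 ⟨hyF, fun hr => hy (mem_singleton.1 hr).symm⟩)

/-- `{r}` is a partner member of `F` at an `r`-only `y`: `{r}` and `{y, r}` are members. -/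
theorem singleton_r_mem_partner (h : RMStar r F u₀) {y : α} (hy : y ≠ r)
    (hy0 : ({y} : Finset α) ∉ part0 r F) : ({r} : Finset α) ∈ partner y F := by
  have h1 := (mem_partr.1 (h.singleton_mem_partr hy hy0)).2
  refine mem_partner_iff.2 ⟨h.singleton_mem, fun hyr => hy (mem_singleton.1 hyr), ?_⟩
  rw [Finset.pair_comm]
  exact h1

/-- At a non-tightening `r`-only direction `y`, `r` lies in the addable part of the partner
family at `y` (Theorem (NT) (2a) at the member `{r}`, which avoids `y`). -/
theorem r_mem_Rstar_partner (h : RMStar r F u₀) {y : α} (hy : y ≠ r)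
    (hy0 : ({y} : Finset α) ∉ part0 r F)
    (hε : (diffsX y F ∩ diffsY y F).card = (partner y F).card) :
    r ∈ Rstar (partner y F) := by
  have hK : (partner y F).Nonempty := ⟨{r}, h.singleton_r_mem_partner hy hy0⟩
  have hs : ({r} : Finset α) ∈ part0 y F :=
    mem_part0.2 ⟨h.singleton_mem, fun hyr => hy (mem_singleton.1 hyr)⟩
  have hmem := inter_Rstar_mem_partner hε hK hs
  by_contra hr
  rw [Finset.singleton_inter_of_notMem hr] at hmem
  exact h.empty_notMem (mem_of_mem_partner hmem)

/-- `∅ ∉ proj y F` for an `r`-only `y`: a member projecting to `∅` is `∅` or `{y}`. -/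
theorem empty_notMem_proj (h : RMStar r F u₀) {y : α} (hy : y ≠ r)
    (hy0 : ({y} : Finset α) ∉ part0 r F) : (∅ : Finset α) ∉ proj y F := by
  intro h0
  obtain ⟨B, hB, hBy⟩ := mem_proj.1 h0
  have hsub : B ⊆ {y} := by
    intro a ha
    rw [mem_singleton]
    by_contra hay
    have : a ∈ B.erase y := mem_erase.2 ⟨hay, ha⟩
    rw [hBy] at this
    exact notMem_empty a this
  rcases Finset.subset_singleton_iff.1 hsub with rfl | rfl
  · exact h.empty_notMem hB
  · exact singleton_notMem hy hy0 hB

/-! ### Lemma 1: the `r`-only elements of `u₀` are tightening directions -/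

/-- If `y` is a non-tightening direction with `r ∈ R_y`, Theorem (NT) (2b) at a member `B ∋ y`
produces the member `B ∪ R_y ∋ r`. -/
theorem union_Rstar_mem {y : α} {B : Finset α} (hB : B ∈ F) (hyB : y ∈ B)
    (hε : (diffsX y F ∩ diffsY y F).card = (partner y F).card) (hK : (partner y F).Nonempty) :
    B ∪ Rstar (partner y F) ∈ F := by
  have ht : B.erase y ∈ partr y F := mem_partr.2 ⟨notMem_erase y B, by rw [insert_erase hyB]; exact hB⟩
  have hmem := union_Rstar_mem_partner hε hK ht
  have h2 := insert_mem_of_mem_partner hmem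
  have : insert y (B.erase y ∪ Rstar (partner y F)) = B ∪ Rstar (partner y F) := by
    rw [← insert_union, insert_erase hyB]
  rwa [this] at h2

/-- **Lemma 1.** Every `r`-only element of `u₀` is a tightening direction of `F`. -/
theorem tight_proj_of_mem_u0 (h : RMStar r F u₀) {y : α} (hy : y ∈ u₀)
    (hy0 : ({y} : Finset α) ∉ part0 r F) : Tight (proj y F) := by
  have hyr : y ≠ r := fun hyr => h.r_notMem_u0 (hyr ▸ hy)
  by_contra hnt
  have hε : (diffsX y F ∩ diffsY y F).card = (partner y F).card := by
    have h1 := card_diffs_eq_card_diffs_proj_add y F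
    have h2 := card_eq_card_proj_add_card_partner y F
    have h3 := Finset.card_le_card_diffs (proj y F)
    have h4 := card_partner_le_card_edges_diffs y F
    have h5 := h.exc
    unfold Tight at hnt
    omega
  have hK : (partner y F).Nonempty := ⟨{r}, h.singleton_r_mem_partner hyr hy0⟩
  have hr := h.r_mem_Rstar_partner hyr hy0 hε
  have hB := union_Rstar_mem h.u0_mem_F hy hε hK
  -- the member `u₀ ∪ R_y` contains `r`; its `r`-erase is an `r`-lifted face above `u₀`
  have h1 : (u₀ ∪ Rstar (partner y F)).erase r ∈ partr r F :=
    mem_partr.2 ⟨notMem_erase r _, by rw [insert_erase (mem_union_right _ hr)]; exact hB⟩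
  have h2 : u₀ ⊆ (u₀ ∪ Rstar (partner y F)).erase r := by
    intro a ha
    exact mem_erase.2 ⟨fun har => h.r_notMem_u0 (har ▸ ha), mem_union_left _ ha⟩
  exact h.u0_notMem (h.down _ h1 u₀ h.u0_mem_proj h2)

/-! ### Lemma 2: at a tightening `r`-only direction the trace is `r`-addable -/

/-- **Lemma 2 (★).** At an `r`-only tightening direction `y`, every member `s` avoiding `r` has
`s.erase y` `r`-lifted: the tight trace `proj y F` contains `{r}` and not `∅`, so by Theorem S the
twin class of `r` is addable in it, and `(s.erase y) ∪ cls r` lifts to a member containing `r`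
above `s.erase y`. -/
theorem erase_mem_partr_of_tight (h : RMStar r F u₀) {y : α} (hy : y ≠ r)
    (hy0 : ({y} : Finset α) ∉ part0 r F) (hT : Tight (proj y F)) {s : Finset α}
    (hs : s ∈ part0 r F) : s.erase y ∈ partr r F := by
  have hrs : r ∉ s := (mem_part0.1 hs).2
  have hsF : s ∈ F := (mem_part0.1 hs).1
  set G := proj y F with hG
  have hrG : ({r} : Finset α) ∈ G := mem_proj.2 ⟨{r}, h.singleton_mem, by
    rw [Finset.erase_eq_of_notMem (fun hyr => hy (mem_singleton.1 hyr))]⟩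
  have h0 : (∅ : Finset α) ∉ G := h.empty_notMem_proj hy hy0
  have hdich := dichotomy_of_tight hT
  rcases hdich r with hadd | hrem
  · -- the class of `r` is addable in `G`
    have hsG : s.erase y ∈ G := mem_proj.2 ⟨s, hsF, rfl⟩
    have hmem := hadd _ hsG
    obtain ⟨B, hB, hBy⟩ := mem_proj.1 hmem
    have hrB : r ∈ B := by
      have : r ∈ B.erase y := by
        rw [hBy]
        exact mem_union_right _ (self_mem_cls G r)
      exact mem_of_mem_erase this
    have h1 : B.erase r ∈ partr r F :=
      mem_partr.2 ⟨notMem_erase r B, by rw [insert_erase hrB]; exact hB⟩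
    have h2 : s.erase y ⊆ B.erase r := by
      intro a ha
      have ha' : a ∈ B.erase y := by
        rw [hBy]
        exact mem_union_left _ ha
      exact mem_erase.2 ⟨fun har => hrs (har ▸ mem_of_mem_erase ha), mem_of_mem_erase ha'⟩
    exact h.down _ h1 _ (h.mem_proj_of_subset' (mem_proj_of_mem_part0 hs) (erase_subset y s)) h2
  · -- the class of `r` is removable: `{r} \ cls r = ∅` would be a member of `G`
    exfalso
    have := hrem _ hrG
    rw [Finset.sdiff_eq_empty_iff_subset.2 (singleton_subset_iff.2 (self_mem_cls G r))] at this
    exact h0 this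

/-- At an `r`-only tightening direction `y`, a member avoiding `r` and `y` is `r`-lifted. -/
theorem mem_partr_of_tight_of_notMem (h : RMStar r F u₀) {y : α} (hy : y ≠ r)
    (hy0 : ({y} : Finset α) ∉ part0 r F) (hT : Tight (proj y F)) {s : Finset α}
    (hs : s ∈ part0 r F) (hys : y ∉ s) : s ∈ partr r F := by
  have := h.erase_mem_partr_of_tight hy hy0 hT hs
  rwa [erase_eq_of_notMem hys] at this

/-- Every partnerless member (avoiding `r`, not `r`-lifted) contains every `r`-only element
of `u₀`. -/
theorem mem_of_partnerless (h : RMStar r F u₀) {y : α} (hy : y ∈ u₀)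
    (hy0 : ({y} : Finset α) ∉ part0 r F) {p : Finset α} (hp0 : p ∈ part0 r F)
    (hp1 : p ∉ partr r F) : y ∈ p := by
  have hyr : y ≠ r := fun hyr => h.r_notMem_u0 (hyr ▸ hy)
  by_contra hyp
  exact hp1 (h.mem_partr_of_tight_of_notMem hyr hy0 (h.tight_proj_of_mem_u0 hy hy0) hp0 hyp)

/-! ### Lemma 3: the `r`-only elements of `ū` are non-tightening directions -/

/-- **Lemma 3.** An `r`-only `z ∈ ū` is not a tightening direction: otherwise Lemma 2 at `z`
would make `u₀ = u₀.erase z` `r`-lifted. -/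
theorem not_tight_proj_of_mem_ubar (h : RMStar r F u₀) {z : α} (hz : z ∈ ubar r u₀)
    (hz0 : ({z} : Finset α) ∉ part0 r F) : ¬ Tight (proj z F) := by
  intro hT
  have hzr : z ≠ r := (mem_ubar.1 hz).1
  have hzu : z ∉ u₀ := (mem_ubar.1 hz).2
  exact h.u0_notMem (h.mem_partr_of_tight_of_notMem hzr hz0 hT h.u0_mem hzu)

/-- The non-tightening hypothesis of Theorem (NT) at an `r`-only `z ∈ ū`. -/
theorem nonTightening_of_mem_ubar (h : RMStar r F u₀) {z : α} (hz : z ∈ ubar r u₀)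
    (hz0 : ({z} : Finset α) ∉ part0 r F) :
    (diffsX z F ∩ diffsY z F).card = (partner z F).card := by
  have hnt := h.not_tight_proj_of_mem_ubar hz hz0
  have h1 := card_diffs_eq_card_diffs_proj_add z F
  have h2 := card_eq_card_proj_add_card_partner z F
  have h3 := Finset.card_le_card_diffs (proj z F)
  have h4 := card_partner_le_card_edges_diffs z F
  have h5 := h.exc
  unfold Tight at hnt
  omega

/-- **Lemma 3 (a).** At an `r`-only `z ∈ ū`, every member avoiding `r` and containing `z` is a
partner member: Theorem (NT) (2b) lifts it to `s ∪ R_z ∋ r`. -/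
theorem mem_partr_of_mem_of_mem_ubar (h : RMStar r F u₀) {z : α} (hz : z ∈ ubar r u₀)
    (hz0 : ({z} : Finset α) ∉ part0 r F) {s : Finset α} (hs : s ∈ part0 r F) (hzs : z ∈ s) :
    s ∈ partr r F := by
  have hzr : z ≠ r := (mem_ubar.1 hz).1
  have hε := h.nonTightening_of_mem_ubar hz hz0
  have hK : (partner z F).Nonempty := ⟨{r}, h.singleton_r_mem_partner hzr hz0⟩
  have hr := h.r_mem_Rstar_partner hzr hz0 hε
  have hB := union_Rstar_mem (mem_part0.1 hs).1 hzs hε hK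
  have h1 : (s ∪ Rstar (partner z F)).erase r ∈ partr r F :=
    mem_partr.2 ⟨notMem_erase r _, by rw [insert_erase (mem_union_right _ hr)]; exact hB⟩
  have h2 : s ⊆ (s ∪ Rstar (partner z F)).erase r := by
    intro a ha
    exact mem_erase.2 ⟨fun har => (mem_part0.1 hs).2 (har ▸ ha), mem_union_left _ ha⟩
  exact h.down _ h1 s (mem_proj_of_mem_part0 hs) h2

/-- The partner family of `F` at an `r`-only non-tightening `z` is tight and closed under
adding the twin class of `r` (Theorem S; the class of `r` is not removable since `∅ ∉ F`). -/
theorem closedAdd_cls_r_partner (h : RMStar r F u₀) {z : α} (hz : z ≠ r)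
    (hz0 : ({z} : Finset α) ∉ part0 r F)
    (hε : (diffsX z F ∩ diffsY z F).card = (partner z F).card) :
    ClosedAdd (partner z F) (cls (partner z F) r) := by
  have hT : Tight (partner z F) := (tight_partner_of_card_eq hε).1
  have hrK : ({r} : Finset α) ∈ partner z F := h.singleton_r_mem_partner hz hz0
  rcases dichotomy_of_tight hT r with hadd | hrem
  · exact hadd
  · exfalso
    have := hrem _ hrK
    rw [Finset.sdiff_eq_empty_iff_subset.2
      (singleton_subset_iff.2 (self_mem_cls (partner z F) r))] at this
    exact h.empty_notMem (mem_of_mem_partner this)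

/-- A member of the partner family at an `r`-only non-tightening `z` that avoids `r` is
`r`-lifted (it lies below the partner member `k ∪ cls r ∋ r`). -/
theorem mem_partr_of_mem_partner_z (h : RMStar r F u₀) {z : α} (hz : z ≠ r)
    (hz0 : ({z} : Finset α) ∉ part0 r F)
    (hε : (diffsX z F ∩ diffsY z F).card = (partner z F).card) {k : Finset α}
    (hk : k ∈ partner z F) (hrk : r ∉ k) : k ∈ partr r F := by
  have hadd := h.closedAdd_cls_r_partner hz hz0 hε
  have hmem := mem_of_mem_partner (hadd _ hk)
  have hrB : r ∈ k ∪ cls (partner z F) r := mem_union_right _ (self_mem_cls _ r)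
  have h1 : (k ∪ cls (partner z F) r).erase r ∈ partr r F :=
    mem_partr.2 ⟨notMem_erase r _, by rw [insert_erase hrB]; exact hmem⟩
  have h2 : k ⊆ (k ∪ cls (partner z F) r).erase r := by
    intro a ha
    exact mem_erase.2 ⟨fun har => hrk (har ▸ ha), mem_union_left _ ha⟩
  have hkP : k ∈ proj r F := mem_proj_of_mem_part0 (mem_part0.2 ⟨mem_of_mem_partner hk, hrk⟩)
  exact h.down _ h1 k hkP h2

/-- **Lemma 3 (b).** At an `r`-only `z ∈ ū`, every member `s` avoiding `r` and `z` has
`s ∩ R_z` a partner member of `F` at `r` (Theorem (NT) (2a), then the `r`-addability of the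
partner family at `z`). -/
theorem inter_Rstar_mem_partner_of_mem_ubar (h : RMStar r F u₀) {z : α} (hz : z ∈ ubar r u₀)
    (hz0 : ({z} : Finset α) ∉ part0 r F) {s : Finset α} (hs : s ∈ part0 r F) (hzs : z ∉ s) :
    s ∩ Rstar (partner z F) ∈ partner r F := by
  have hzr : z ≠ r := (mem_ubar.1 hz).1
  have hε := h.nonTightening_of_mem_ubar hz hz0
  have hK : (partner z F).Nonempty := ⟨{r}, h.singleton_r_mem_partner hzr hz0⟩
  have hs' : s ∈ part0 z F := mem_part0.2 ⟨(mem_part0.1 hs).1, hzs⟩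
  have hmem := inter_Rstar_mem_partner hε hK hs'
  have hrk : r ∉ s ∩ Rstar (partner z F) := fun hr => (mem_part0.1 hs).2 (mem_inter.1 hr).1
  refine mem_inter.2 ⟨mem_part0.2 ⟨mem_of_mem_partner hmem, hrk⟩, ?_⟩
  exact h.mem_partr_of_mem_partner_z hzr hz0 hε hmem hrk

/-- The partner member `q_z = u₀ ∩ R_z` inside `u₀`, for an `r`-only `z ∈ ū`. -/
theorem inter_u0_Rstar_mem_partner (h : RMStar r F u₀) {z : α} (hz : z ∈ ubar r u₀)
    (hz0 : ({z} : Finset α) ∉ part0 r F) : u₀ ∩ Rstar (partner z F) ∈ partner r F :=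
  h.inter_Rstar_mem_partner_of_mem_ubar hz hz0 h.u0_mem (mem_ubar.1 hz).2

end RMStar

end PercRepro.MSTight
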